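import Literature.Analysis.UnboundedOperators.HeatKernelBoundedData
import HarnessLib

/-!
# The sharp Euclidean Harnack inequality for caloric extensions of bounded nonnegative data

Analysis/UnboundedOperators file (all results proved, no definitions, no named facts). For a
finite-dimensional real inner product space `E` (`n = finrank E`), the Gauss–Weierstrass kernel
`G_t = heatKernel t` and a continuous `f : E → ℝ` with `0 ≤ f ≤ M`:

  `(e^{sΔ}f)(y) ≤ (t/s)^{n/2} exp(‖x − y‖²/(4(t − s))) (e^{tΔ}f)(x)`   for `0 < s < t`

(`heatExtension_le_harnack`): an EARLIER value at ANY point is controlled by a later value, with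
the Gaussian price `exp(‖x−y‖²/(4(t−s)))` — the Li–Yau differential Harnack inequality for the heat
equation on `ℝⁿ` in its sharp integrated form (Li–Yau 1986, Thm. 2.1 with zero curvature; for
caloric extensions of nonnegative data it is the pointwise kernel-ratio inequality
`G_s(y − z) ≤ (t/s)^{n/2} e^{‖x−y‖²/(4(t−s))} G_t(x − z)`, `heatKernel_le_mul_heatKernel`, i.e. the
parallelogram-type inequality `‖a + b‖²/(p + q) ≤ ‖a‖²/p + ‖b‖²/q`, integrated against `f ≥ 0`).
Used in `Summits/NavierStokesRegularity` (route `LevelSetModeration`, item `HighSpeedPressureWork`)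
to propagate the smallness of a caloric deficit at a fast point backwards in time and sideways in
space.

## References

* P. Li, S.-T. Yau, *On the parabolic kernel of the Schrödinger operator*, Acta Math. 156 (1986)
  153–201, Thm. 2.1 / Cor. (Harnack for positive solutions). [folklore]
* L. C. Evans, *Partial Differential Equations*, 2nd ed., §2.3.1 (heat kernel). [folklore]
-/

open MeasureTheory Filter Topology Set InnerProductSpace Metric
open scoped Real RealInnerProductSpace

noncomputable section

namespace Literature.Analysis.UnboundedOperators

variable {E : Type*} [NormedAddCommGroup E] [InnerProductSpace ℝ E] [FiniteDimensional ℝ E]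
  [MeasurableSpace E] [BorelSpace E]

omit [FiniteDimensional ℝ E] [MeasurableSpace E] [BorelSpace E] in
/-- **Parallelogram-type inequality** `‖a + b‖² p q ≤ (‖a‖² q + ‖b‖² p)(p + q)`, i.e.
`‖a + b‖²/(p + q) ≤ ‖a‖²/p + ‖b‖²/q` for `p, q > 0` (the difference is `‖q•a − p•b‖²`). [folklore] -/
theorem norm_add_sq_mul_mul_le (a b : E) (p q : ℝ) :
    ‖a + b‖ ^ 2 * (p * q) ≤ (‖a‖ ^ 2 * q + ‖b‖ ^ 2 * p) * (p + q) := by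
  have h0 : 0 ≤ ‖q • a - p • b‖ ^ 2 := sq_nonneg _
  have h1 : ‖q • a - p • b‖ ^ 2 = q ^ 2 * ‖a‖ ^ 2 - 2 * (p * q) * ⟪a, b⟫ + p ^ 2 * ‖b‖ ^ 2 := by
    rw [@norm_sub_sq ℝ, norm_smul, norm_smul, real_inner_smul_left, real_inner_smul_right,
      Real.norm_eq_abs, Real.norm_eq_abs]
    simp only [RCLike.re_to_real]
    rw [mul_pow, mul_pow, sq_abs, sq_abs]
    ring
  have h2 : ‖a + b‖ ^ 2 = ‖a‖ ^ 2 + 2 * ⟪a, b⟫ + ‖b‖ ^ 2 := by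
    rw [@norm_add_sq ℝ]; simp only [RCLike.re_to_real]
  rw [h2]
  nlinarith [h0, h1]

omit [FiniteDimensional ℝ E] [MeasurableSpace E] [BorelSpace E] in
/-- **Kernel-ratio inequality** behind the sharp Harnack inequality: for `0 < s < t` and all
`x, y, z`, `G_s(y − z) ≤ (t/s)^{n/2} e^{‖x−y‖²/(4(t−s))} G_t(x − z)`. [folklore] -/
theorem heatKernel_le_mul_heatKernel {s t : ℝ} (hs : 0 < s) (hst : s < t) (x y z : E) :
    heatKernel s (y - z) ≤
      (t / s) ^ ((Module.finrank ℝ E : ℝ) / 2) * Real.exp (‖x - y‖ ^ 2 / (4 * (t - s))) *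
        heatKernel t (x - z) := by
  have ht : 0 < t := hs.trans hst
  have hts : 0 < t - s := sub_pos.2 hst
  set c : ℝ := (Module.finrank ℝ E : ℝ) / 2 with hc
  -- normalisation constants: `(t/s)^c (4πt)^{-c} = (4πs)^{-c}`
  have hnorm : (t / s) ^ c * (4 * π * t) ^ (-(Module.finrank ℝ E : ℝ) / 2) =
      (4 * π * s) ^ (-(Module.finrank ℝ E : ℝ) / 2) := by
    have hneg : -(Module.finrank ℝ E : ℝ) / 2 = -c := by rw [hc]; ring
    rw [hneg, Real.rpow_neg (by positivity), Real.rpow_neg (by positivity),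
      Real.div_rpow ht.le hs.le, Real.mul_rpow (by positivity) ht.le,
      Real.mul_rpow (by positivity) hs.le]
    have h1 : 0 < t ^ c := Real.rpow_pos_of_pos ht c
    have h2 : 0 < s ^ c := Real.rpow_pos_of_pos hs c
    have h3 : 0 < (4 * π) ^ c := Real.rpow_pos_of_pos (by positivity) c
    field_simp
  -- the exponents: `-‖y-z‖²/(4s) ≤ ‖x-y‖²/(4(t-s)) - ‖x-z‖²/(4t)`
  have hexp : -‖y - z‖ ^ 2 / (4 * s) ≤ ‖x - y‖ ^ 2 / (4 * (t - s)) + -‖x - z‖ ^ 2 / (4 * t) := by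
    have hpar := norm_add_sq_mul_mul_le (x - y) (y - z) (t - s) s
    rw [show x - y + (y - z) = x - z by abel, show t - s + s = t by ring] at hpar
    rw [div_add_div _ _ (by positivity) (by positivity), le_div_iff₀ (by positivity),
      div_mul_eq_mul_div, div_le_iff₀ (by positivity)]
    nlinarith [hpar, hs, hts, ht]
  simp only [heatKernel]
  calc (4 * π * s) ^ (-(Module.finrank ℝ E : ℝ) / 2) * Real.exp (-‖y - z‖ ^ 2 / (4 * s))
      ≤ (4 * π * s) ^ (-(Module.finrank ℝ E : ℝ) / 2) *
          Real.exp (‖x - y‖ ^ 2 / (4 * (t - s)) + -‖x - z‖ ^ 2 / (4 * t)) :=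
        mul_le_mul_of_nonneg_left (Real.exp_le_exp.2 hexp) (by positivity)
    _ = (t / s) ^ c * Real.exp (‖x - y‖ ^ 2 / (4 * (t - s))) *
          ((4 * π * t) ^ (-(Module.finrank ℝ E : ℝ) / 2) * Real.exp (-‖x - z‖ ^ 2 / (4 * t))) := by
        rw [Real.exp_add, ← hnorm]; ring

/-- The caloric extension of bounded continuous data as an integral against the translated
kernel: `e^{tΔ}f(x) = ∫ G_t(x − z) f(z) dz`. [folklore] -/
theorem heatExtension_eq_integral_mul (f : E → ℝ) (t : ℝ) (x : E) :
    heatExtension f t x = ∫ z, heatKernel t (x - z) * f z := by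
  rw [heatExtension_apply]
  have h := integral_sub_left_eq_self (fun z => heatKernel t (x - z) * f z) volume x
  simp only [sub_sub_cancel] at h
  rw [← h]
  rfl

/-- Integrability of `z ↦ G_t(x − z) f(z)` for bounded continuous `f`, `0 < t`. [folklore] -/
theorem integrable_heatKernel_sub_mul {f : E → ℝ} (hf : Continuous f) {M : ℝ}
    (hfM : ∀ z, ‖f z‖ ≤ M) {t : ℝ} (ht : 0 < t) (x : E) :
    Integrable (fun z => heatKernel t (x - z) * f z) := by
  have hK := (integrable_heatKernel_holds (E := E) ht).comp_sub_left x
  refine (hK.mul_const M).mono' ?_ (Eventually.of_forall fun z => ?_)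
  · exact (((continuous_heatKernel t).comp (continuous_const.sub continuous_id)).mul
      hf).aestronglyMeasurable
  · rw [norm_mul, Real.norm_of_nonneg (heatKernel_pos ht _).le]
    exact mul_le_mul_of_nonneg_left (hfM z) (heatKernel_pos ht _).le

/-- **Sharp Euclidean Harnack inequality for caloric extensions of bounded nonnegative data.**
For continuous `0 ≤ f ≤ M`, `0 < s < t` and all `x, y`:

  `(e^{sΔ}f)(y) ≤ (t/s)^{n/2} exp(‖x − y‖²/(4(t − s))) (e^{tΔ}f)(x)`.

(Li–Yau 1986, Thm. 2.1 at zero curvature, integrated form; here from the kernel-ratio inequality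
`heatKernel_le_mul_heatKernel` integrated against `f ≥ 0`.) [folklore] -/
theorem heatExtension_le_harnack {f : E → ℝ} (hf : Continuous f) {M : ℝ} (hf0 : ∀ z, 0 ≤ f z)
    (hfM : ∀ z, f z ≤ M) {s t : ℝ} (hs : 0 < s) (hst : s < t) (x y : E) :
    heatExtension f s y ≤
      (t / s) ^ ((Module.finrank ℝ E : ℝ) / 2) * Real.exp (‖x - y‖ ^ 2 / (4 * (t - s))) *
        heatExtension f t x := by
  have ht : 0 < t := hs.trans hst
  have hfb : ∀ z, ‖f z‖ ≤ M := fun z => by rw [Real.norm_of_nonneg (hf0 z)]; exact hfM z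
  set C : ℝ := (t / s) ^ ((Module.finrank ℝ E : ℝ) / 2) * Real.exp (‖x - y‖ ^ 2 / (4 * (t - s)))
    with hC
  rw [heatExtension_eq_integral_mul f s y, heatExtension_eq_integral_mul f t x, ← integral_const_mul]
  refine integral_mono (integrable_heatKernel_sub_mul hf hfb hs y)
    ((integrable_heatKernel_sub_mul hf hfb ht x).const_mul C) fun z => ?_
  dsimp only
  rw [← mul_assoc]
  exact mul_le_mul_of_nonneg_right (heatKernel_le_mul_heatKernel hs hst x y z) (hf0 z)

/-- **Harnack inequality, time-shifted form**: for the caloric extension started at time `s₀`,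
`(e^{(σ−s₀)Δ}f)(y) ≤ ((t−s₀)/(σ−s₀))^{n/2} exp(‖x−y‖²/(4(t−σ))) (e^{(t−s₀)Δ}f)(x)` for
`s₀ < σ < t`. [folklore] -/
theorem heatExtension_le_harnack_shift {f : E → ℝ} (hf : Continuous f) {M : ℝ} (hf0 : ∀ z, 0 ≤ f z)
    (hfM : ∀ z, f z ≤ M) {s₀ σ t : ℝ} (hs : s₀ < σ) (hσt : σ < t) (x y : E) :
    heatExtension f (σ - s₀) y ≤
      ((t - s₀) / (σ - s₀)) ^ ((Module.finrank ℝ E : ℝ) / 2) *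
        Real.exp (‖x - y‖ ^ 2 / (4 * (t - σ))) * heatExtension f (t - s₀) x := by
  have h := heatExtension_le_harnack hf hf0 hfM (sub_pos.2 hs) (by linarith : σ - s₀ < t - s₀) x y
  rwa [show t - s₀ - (σ - s₀) = t - σ by ring] at h

end Literature.Analysis.UnboundedOperators

end
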